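import Summits.ResolutionOfSingularities.ResolutionOfSingularities.Theorems.DeltaCutRefCertificates3
import HarnessLib

/-!
# DeltaCutRefCertificates4 — decomp-res node «RefCut (certificates)» (lens-6 g27, critic row 204 CLEARED (F-curve
WHOLE) DECIDED +1 · MAP 0), tree file 4/5 of the node

Content VERBATIM from the decomp-res lens-6 g27 certificate file
`HOME/decomp-res-lens-6/g27/RefCutCertificates.lean` (pin 745ed495; ring level, imports the landed
`DeltaCutSepCertificates5`; namespace `…Theorems.DeltaCutClasses`, section `RefCertificates`); HOME =
run/shared/lean/pub/decomp-res; critic CRITIC-LEDGER row 204 CLEARED (F-curve WHOLE) DECIDED +1 · MAP 0; landing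
orders NEXT-g28.md §4 (F) + INBOX :1315 — provenance, critic text and the lens header in full in the first
certificate file `DeltaCutRefCertificates`.  `--kind proof --supports stmt-ResolutionOfSingularities-26971`.

## This file

Continuation 4/5 of `DeltaCutRefCertificates` (same namespace / sections of the node, cut at the tree's 400-line
cap; section variables / opens replayed): scopes `RefCertificates` — carries `Cx_C_lineChart_X1_top`,
`Cx_C_nu_lines`, `Cx_C_dd_b`, `Cx_gamma_separable`, `Cx_C_tame_nu`, `Cx_C_wild_near_Q0`, `Cx_C_isPinf_b`,
`Cx_D_lineChart_X2`, `Cx_D_lineChart_X3`, `Cx_D_lineChart_X0`, `Cx_D_lineChart_X2_noTop`, `Cx_D_lineChart_X3_top`,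
`Cx_D_lineChart_X0_noTop`, `Cx_D_muChart_h`.

[WRITER NOTE (decomp-res writer g13): file split only (tree files ≤ 400 lines, cut at declaration boundaries);
namespace, the section `RefCertificates` with its `open MvPolynomial` / `variable {K : Type*} [Field K]`, and every
declaration exactly as in the lens (the HOME-only dupNamespace-linter line is dropped — the library sets it;
`noncomputable section`, the file-level `open` lines, `universe u` and `open …Rescue.BedZpeBinom4Centre
(mul_mem_pow_add)` are replayed in every part).]

(Sources: Hironaka1967; CossartJannsenSaito2020 Def. 3.13 / Thm. 3.14, Ch. 8, Thm. 9.6; Hironaka1970;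
CossartPiltant2019 Prop. 2.6; CossartPiltant2008 §2; Giraud1975; Hironaka2005; EGAIV4 §16–§18; StacksProject 0804 /
0BIQ / 031I / 039P; Matsumura1987 §28–§30; Kollar2007 Thm. 1.101.)
-/

noncomputable section

open CategoryTheory CategoryTheory.Limits AlgebraicGeometry TopologicalSpace IsLocalRing
open Literature.AlgebraicGeometry.Resolution

universe u

open Summit.ResolutionOfSingularities.ResolutionOfSingularities.Theorems.Rescue.BedZpeBinom4Centre (mul_mem_pow_add)

namespace Summit.ResolutionOfSingularities.ResolutionOfSingularities.Theorems.DeltaCutClasses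

open Summit.ResolutionOfSingularities.ResolutionOfSingularities.Theorems.TwistCutClasses
open Summit.ResolutionOfSingularities.ResolutionOfSingularities.Theorems.LightCutClasses

section RefCertificates

open MvPolynomial
variable {K : Type*} [Field K]

/-! ##### chart `b` of the blow-up of `L̃`: the fifth top direction `ν` and the bad point `Q₀` -/

/-- **chart `b` — THE TOP LOCUS of `g₃' = α³ + b²·γ·w'·(1+γ⁴)` is `ν ∪ λ ∪ μ`**: a prime of order `≥ 3` contains
`α`, `b`, and `γ` or
`w'` or `1+γ⁴` (`∂_{w'}`: `s²·b²γ(1+γ⁴) ∈ 𝔮²`, then `∂_γ`: `b²(1+5γ⁴)` and `∂_b`: `2bγ(1+γ⁴)` ⟹ `b ∈ 𝔮` (else `1+5γ⁴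
∈ 𝔮` and `γ ∈ 𝔮`
(`1 ∈ 𝔮`) or `1+γ⁴ ∈ 𝔮` (`4 ∈ 𝔮`)); `α³`; `∂_b∂_b`: `2γw'(1+γ⁴) ∈ 𝔮`). [new; elementary] [folklore] -/
theorem Cx_C_lineChart_X1_top [CharP K 3] (𝔮 : Ideal (MvPolynomial (Fin 4) K)) [𝔮.IsPrime] {s : MvPolynomial (Fin 4) K}
    (hs : s ∉ 𝔮) (h : s * (X 0 ^ 3 + X 1 ^ 2 * X 2 * X 3 * (1 + X 2 ^ 4) : MvPolynomial (Fin 4) K) ∈ 𝔮 ^ 3) :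
    (X 0 : MvPolynomial (Fin 4) K) ∈ 𝔮 ∧ (X 1 : MvPolynomial (Fin 4) K) ∈ 𝔮 ∧
      ((X 2 : MvPolynomial (Fin 4) K) ∈ 𝔮 ∨ (X 3 : MvPolynomial (Fin 4) K) ∈ 𝔮 ∨ (1 + X 2 ^ 4 : MvPolynomial (Fin 4) K) ∈ 𝔮) := by
  have hs2 : s ^ 2 ∉ 𝔮 := pow_not_mem 𝔮 hs 2
  have hs4 : (s ^ 2) ^ 2 ∉ 𝔮 := pow_not_mem 𝔮 hs2 2
  have h4 : (4 : MvPolynomial (Fin 4) K) ∉ 𝔮 := by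
    have := natCast_not_mem (K := K) 𝔮 (m := 4) (by decide)
    exact_mod_cast this
  have h2 : (2 : MvPolynomial (Fin 4) K) ∉ 𝔮 := two_not_mem (K := K) 𝔮
  have e10 := f_ne K (i := 1) (j := 0) (by decide)
  have e12 := f_ne K (i := 1) (j := 2) (by decide)
  have e13 := f_ne K (i := 1) (j := 3) (by decide)
  have e21 := f_ne K (i := 2) (j := 1) (by decide)
  have e23 := f_ne K (i := 2) (j := 3) (by decide)
  have e30 := f_ne K (i := 3) (j := 0) (by decide)
  have e31 := f_ne K (i := 3) (j := 1) (by decide)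
  have e32 := f_ne K (i := 3) (j := 2) (by decide)
  have e11 := f_self K 1
  have e22 := f_self K 2
  have e33 := f_self K 3
  have d3 : pderiv 3 (X 0 ^ 3 + X 1 ^ 2 * X 2 * X 3 * (1 + X 2 ^ 4) : MvPolynomial (Fin 4) K) = X 1 ^ 2 * X 2 * (1 + X 2 ^ 4) := by
    simp only [map_add, Derivation.leibniz, Derivation.leibniz_pow, smul_eq_mul, nsmul_eq_mul, e30, e31, e32, e33, f_one]
    push_cast; ring
  have d32 : pderiv 2 (X 1 ^ 2 * X 2 * (1 + X 2 ^ 4) : MvPolynomial (Fin 4) K) = X 1 ^ 2 * (1 + 5 * X 2 ^ 4) := by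
    simp only [map_add, Derivation.leibniz, Derivation.leibniz_pow, smul_eq_mul, nsmul_eq_mul, e21, e22, f_one]
    push_cast; ring
  have d31 : pderiv 1 (X 1 ^ 2 * X 2 * (1 + X 2 ^ 4) : MvPolynomial (Fin 4) K) = 2 * (X 1 * X 2 * (1 + X 2 ^ 4)) := by
    simp only [map_add, Derivation.leibniz, Derivation.leibniz_pow, smul_eq_mul, nsmul_eq_mul, e11, e12, f_one]
    push_cast; ring
  have d1 : pderiv 1 (X 0 ^ 3 + X 1 ^ 2 * X 2 * X 3 * (1 + X 2 ^ 4) : MvPolynomial (Fin 4) K) = 2 * (X 1 * X 2 * X 3 * (1 + X 2 ^ 4)) := by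
    simp only [map_add, Derivation.leibniz, Derivation.leibniz_pow, smul_eq_mul, nsmul_eq_mul, e10, e11, e12, e13, f_one]
    push_cast; ring
  have d11 : pderiv 1 (2 * (X 1 * X 2 * X 3 * (1 + X 2 ^ 4)) : MvPolynomial (Fin 4) K) = 2 * (X 2 * X 3 * (1 + X 2 ^ 4)) := by
    simp only [map_add, Derivation.leibniz, Derivation.leibniz_pow, smul_eq_mul, nsmul_eq_mul, e11, e12, e13, f_one, f_two]
    push_cast; ring
  have mem_c : ∀ {c x : MvPolynomial (Fin 4) K}, c ∉ 𝔮 → (s ^ 2) ^ 2 * (c * x) ∈ 𝔮 → x ∈ 𝔮 := fun hc hx => by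
    rcases ‹𝔮.IsPrime›.mem_or_mem hx with h' | h'
    · exact absurd h' hs4
    exact (‹𝔮.IsPrime›.mem_or_mem h').resolve_left hc
  have h3 := sq_mul_deriv_mem_pow 𝔮 h (pderiv 3)
  rw [d3] at h3
  have h32 := sq_mul_deriv_mem_pow 𝔮 h3 (pderiv 2)
  rw [d32, pow_one] at h32
  have h31 := sq_mul_deriv_mem_pow 𝔮 h3 (pderiv 1)
  rw [d31, pow_one] at h31
  have hB : (X 1 * X 2 * (1 + X 2 ^ 4) : MvPolynomial (Fin 4) K) ∈ 𝔮 := mem_c h2 h31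
  have hX1 : (X 1 : MvPolynomial (Fin 4) K) ∈ 𝔮 := by
    by_contra hX1
    have hA : (1 + 5 * X 2 ^ 4 : MvPolynomial (Fin 4) K) ∈ 𝔮 := by
      rcases ‹𝔮.IsPrime›.mem_or_mem ((‹𝔮.IsPrime›.mem_or_mem h32).resolve_left hs4) with h' | h'
      · exact absurd (‹𝔮.IsPrime›.mem_of_pow_mem 2 h') hX1
      · exact h'
    rcases ‹𝔮.IsPrime›.mem_or_mem hB with h' | h'
    · rcases ‹𝔮.IsPrime›.mem_or_mem h' with h1 | hγ
      · exact hX1 h1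
      · have h1mem : (1 : MvPolynomial (Fin 4) K) ∈ 𝔮 := by
          have := Ideal.sub_mem _ hA (Ideal.mul_mem_left _ (5 * X 2 ^ 3) hγ)
          rwa [show (1 + 5 * X 2 ^ 4 - 5 * X 2 ^ 3 * X 2 : MvPolynomial (Fin 4) K) = 1 by ring] at this
        exact one_not_mem_of_isPrime 𝔮 h1mem
    · have h4mem : (4 : MvPolynomial (Fin 4) K) ∈ 𝔮 := by
        have := Ideal.sub_mem _ (Ideal.mul_mem_left _ 5 h') hA
        rwa [show (5 * (1 + X 2 ^ 4) - (1 + 5 * X 2 ^ 4) : MvPolynomial (Fin 4) K) = 4 by ring] at this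
      exact h4 h4mem
  have hf : (X 0 ^ 3 + X 1 ^ 2 * X 2 * X 3 * (1 + X 2 ^ 4) : MvPolynomial (Fin 4) K) ∈ 𝔮 := mem_of_sMul_mem_cube 𝔮 hs h
  have hX0 : (X 0 : MvPolynomial (Fin 4) K) ∈ 𝔮 := by
    refine ‹𝔮.IsPrime›.mem_of_pow_mem 3 ?_
    have := Ideal.sub_mem _ hf (Ideal.mul_mem_right (1 + X 2 ^ 4) _
      (Ideal.mul_mem_right (X 3) _ (Ideal.mul_mem_right (X 2) _ (Ideal.pow_mem_of_mem 𝔮 hX1 2 (by norm_num)))))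
    rwa [add_sub_cancel_right] at this
  have h1 := sq_mul_deriv_mem_pow 𝔮 h (pderiv 1)
  rw [d1] at h1
  have h11 := sq_mul_deriv_mem_pow 𝔮 h1 (pderiv 1)
  rw [d11, pow_one] at h11
  have hC : (X 2 * X 3 * (1 + X 2 ^ 4) : MvPolynomial (Fin 4) K) ∈ 𝔮 := mem_c h2 h11
  refine ⟨hX0, hX1, ?_⟩
  rcases ‹𝔮.IsPrime›.mem_or_mem hC with h' | h'
  · rcases ‹𝔮.IsPrime›.mem_or_mem h' with h'' | h''
    · exact Or.inl h''
    · exact Or.inr (Or.inl h'')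
  · exact Or.inr (Or.inr h')

/-- **chart `b` — the TOP LINES `ν = V(α, b, γ)` and `λ = V(α, b, w')`**: `g₃' ∈ P_ν³`, `w' ∉ P_ν` (so `ν` is a
line, `w'` free), `g₃' ∈ P_λ³`,
`γ ∉ P_λ` (`λ` again, now with its point `β = ∞`). [new; elementary] [folklore] -/
theorem Cx_C_nu_lines :
    (X 0 ^ 3 + X 1 ^ 2 * X 2 * X 3 * (1 + X 2 ^ 4) : MvPolynomial (Fin 4) K) ∈ (Ideal.span {(X 0 : MvPolynomial (Fin 4) K), X 1, X 2}) ^ 3 ∧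
      (X 3 : MvPolynomial (Fin 4) K) ∉ Ideal.span {(X 0 : MvPolynomial (Fin 4) K), X 1, X 2} ∧
      (X 0 ^ 3 + X 1 ^ 2 * X 2 * X 3 * (1 + X 2 ^ 4) : MvPolynomial (Fin 4) K) ∈
        (Ideal.span {(X 0 : MvPolynomial (Fin 4) K), X 1, X 3}) ^ 3 ∧
      (X 2 : MvPolynomial (Fin 4) K) ∉ Ideal.span {(X 0 : MvPolynomial (Fin 4) K), X 1, X 3} := by
  have hn0 : (X 0 : MvPolynomial (Fin 4) K) ∈ Ideal.span {(X 0 : MvPolynomial (Fin 4) K), X 1, X 2} := Ideal.subset_span (by simp)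
  have hn1 : (X 1 : MvPolynomial (Fin 4) K) ∈ Ideal.span {(X 0 : MvPolynomial (Fin 4) K), X 1, X 2} := Ideal.subset_span (by simp)
  have hn2 : (X 2 : MvPolynomial (Fin 4) K) ∈ Ideal.span {(X 0 : MvPolynomial (Fin 4) K), X 1, X 2} := Ideal.subset_span (by simp)
  have hl0 : (X 0 : MvPolynomial (Fin 4) K) ∈ Ideal.span {(X 0 : MvPolynomial (Fin 4) K), X 1, X 3} := Ideal.subset_span (by simp)
  have hl1 : (X 1 : MvPolynomial (Fin 4) K) ∈ Ideal.span {(X 0 : MvPolynomial (Fin 4) K), X 1, X 3} := Ideal.subset_span (by simp)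
  have hl3 : (X 3 : MvPolynomial (Fin 4) K) ∈ Ideal.span {(X 0 : MvPolynomial (Fin 4) K), X 1, X 3} := Ideal.subset_span (by simp)
  refine ⟨?_, ?_, ?_, ?_⟩
  · refine Ideal.add_mem _ (Ideal.pow_mem_pow hn0 3) ?_
    have h12 : (X 1 ^ 2 * X 2 : MvPolynomial (Fin 4) K) ∈ (Ideal.span {(X 0 : MvPolynomial (Fin 4) K), X 1, X 2}) ^ (2 + 1) :=
      mul_mem_pow_add (Ideal.pow_mem_pow hn1 2) (by rw [pow_one]; exact hn2)
    exact Ideal.mul_mem_right _ _ (Ideal.mul_mem_right _ _ h12)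
  · refine not_mem_span_of_eval _ (fun i => if i = 3 then 1 else 0) ?_ (by simp)
    intro g hg
    simp only [Set.mem_insert_iff, Set.mem_singleton_iff] at hg
    rcases hg with rfl | rfl | rfl <;> simp
  · refine Ideal.add_mem _ (Ideal.pow_mem_pow hl0 3) ?_
    have h13 : (X 1 ^ 2 * X 3 : MvPolynomial (Fin 4) K) ∈ (Ideal.span {(X 0 : MvPolynomial (Fin 4) K), X 1, X 3}) ^ (2 + 1) :=
      mul_mem_pow_add (Ideal.pow_mem_pow hl1 2) (by rw [pow_one]; exact hl3)
    rw [show (X 1 ^ 2 * X 2 * X 3 * (1 + X 2 ^ 4) : MvPolynomial (Fin 4) K) = X 1 ^ 2 * X 3 * (X 2 * (1 + X 2 ^ 4)) by ring]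
    exact Ideal.mul_mem_right _ _ h13
  · refine not_mem_span_of_eval _ (fun i => if i = 2 then 1 else 0) ?_ (by simp)
    intro g hg
    simp only [Set.mem_insert_iff, Set.mem_singleton_iff] at hg
    rcases hg with rfl | rfl | rfl <;> simp

/-- `∂_b∂_b g₃' = 2·(γ·w'·(1+γ⁴))` — the order-`2` operator extracting the tame element along `ν` (and `λ`) in chart
`b`. [elementary]
[folklore] -/
theorem Cx_C_dd_b :
    (pderiv 1) ((pderiv 1) (X 0 ^ 3 + X 1 ^ 2 * X 2 * X 3 * (1 + X 2 ^ 4) : MvPolynomial (Fin 4) K)) = 2 * (X 2 * X 3 * (1 + X 2 ^ 4)) := by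
  have e10 := f_ne K (i := 1) (j := 0) (by decide)
  have e12 := f_ne K (i := 1) (j := 2) (by decide)
  have e13 := f_ne K (i := 1) (j := 3) (by decide)
  have e11 := f_self K 1
  have d1 : pderiv 1 (X 0 ^ 3 + X 1 ^ 2 * X 2 * X 3 * (1 + X 2 ^ 4) : MvPolynomial (Fin 4) K) = 2 * (X 1 * X 2 * X 3 * (1 + X 2 ^ 4)) := by
    simp only [map_add, Derivation.leibniz, Derivation.leibniz_pow, smul_eq_mul, nsmul_eq_mul, e10, e11, e12, e13, f_one]
    push_cast; ring
  rw [d1]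
  simp only [map_add, Derivation.leibniz, Derivation.leibniz_pow, smul_eq_mul, nsmul_eq_mul, e11, e12, e13, f_one, f_two]
  push_cast; ring

/-- **`γ̂ = γ·(1+γ⁴)` IS AN ÉTALE COORDINATE ALONG `ν`**: `∂_γ γ̂ = 1 + 5γ⁴`, a unit at every prime containing `γ`
(dictionary (E) at
`Q₀` and along `ν`). [elementary] [folklore] -/
theorem Cx_gamma_separable (𝔮 : Ideal (MvPolynomial (Fin 4) K)) [𝔮.IsPrime] (hγ : (X 2 : MvPolynomial (Fin 4) K) ∈ 𝔮) :
    pderiv 2 (X 2 * (1 + X 2 ^ 4) : MvPolynomial (Fin 4) K) = 1 + 5 * X 2 ^ 4 ∧ (1 + 5 * X 2 ^ 4 : MvPolynomial (Fin 4) K) ∉ 𝔮 := by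
  have e22 := f_self K 2
  refine ⟨?_, fun hmem => ?_⟩
  · simp only [map_add, Derivation.leibniz, Derivation.leibniz_pow, smul_eq_mul, nsmul_eq_mul, e22, f_one]
    push_cast; ring
  · have h1mem : (1 : MvPolynomial (Fin 4) K) ∈ 𝔮 := by
      have := Ideal.sub_mem _ hmem (Ideal.mul_mem_left _ (5 * X 2 ^ 3) hγ)
      rwa [show (1 + 5 * X 2 ^ 4 - 5 * X 2 ^ 3 * X 2 : MvPolynomial (Fin 4) K) = 1 by ring] at this
    exact one_not_mem_of_isPrime 𝔮 h1mem

/-- **TAME along `ν` off `Q₀`** (and off `μ`, automatic: `γ ∈ 𝔫 ⟹ 1+γ⁴ ∉ 𝔫`): at a prime `𝔫 ∋ γ` with `w' ∉ 𝔫`, `e =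
γ·w'·(1+γ⁴) ∈ 𝔫` is a
REGULAR PARAMETER (`s'·e ∈ 𝔫²` ⟹ `∂_γ`: `s'·w'·(1+5γ⁴) ∈ 𝔫`, absurd by `Cx_gamma_separable`).  With `Cx_C_dd_b`:
absolute contact.
[new; elementary] [folklore] -/
theorem Cx_C_tame_nu (𝔫 : Ideal (MvPolynomial (Fin 4) K)) [𝔫.IsPrime] (hγ : (X 2 : MvPolynomial (Fin 4) K) ∈ 𝔫)
    (h3 : (X 3 : MvPolynomial (Fin 4) K) ∉ 𝔫) :
    (X 2 * X 3 * (1 + X 2 ^ 4) : MvPolynomial (Fin 4) K) ∈ 𝔫 ∧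
      ∀ s' ∉ 𝔫, s' * (X 2 * X 3 * (1 + X 2 ^ 4) : MvPolynomial (Fin 4) K) ∉ 𝔫 ^ 2 := by
  refine ⟨Ideal.mul_mem_right _ _ (Ideal.mul_mem_right _ _ hγ), fun s' hs' hmem => ?_⟩
  obtain ⟨dγ, hunit⟩ := Cx_gamma_separable 𝔫 hγ
  have e23 := f_ne K (i := 2) (j := 3) (by decide)
  have d : pderiv 2 (X 2 * X 3 * (1 + X 2 ^ 4) : MvPolynomial (Fin 4) K) = X 3 * (1 + 5 * X 2 ^ 4) := by
    rw [show (X 2 * X 3 * (1 + X 2 ^ 4) : MvPolynomial (Fin 4) K) = X 3 * (X 2 * (1 + X 2 ^ 4)) by ring, Derivation.leibniz, dγ,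
      e23, smul_eq_mul, smul_zero, add_zero]
  have hD := derivation_pow_succ_mem (pderiv 2 : Derivation K (MvPolynomial (Fin 4) K) _) _ 1 hmem
  rw [pow_one, Derivation.leibniz, d, smul_eq_mul, smul_eq_mul] at hD
  have h' : s' * (X 3 * (1 + 5 * X 2 ^ 4)) ∈ 𝔫 := by
    have := Ideal.sub_mem _ hD (Ideal.mul_mem_right (pderiv 2 s') _ (Ideal.mul_mem_right (1 + X 2 ^ 4) _ (Ideal.mul_mem_right (X 3) _ hγ)))
    rwa [add_sub_cancel_right] at this
  rcases ‹𝔫.IsPrime›.mem_or_mem h' with h'' | h''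
  · exact hs' h''
  rcases ‹𝔫.IsPrime›.mem_or_mem h'' with h3' | h5
  · exact h3 h3'
  · exact hunit h5

/-- **WILD with a NEAR point at `Q₀ = ν ∩ λ`** (the origin of chart `b`, a genuine polynomial point): `g₃' = α³ +
r`, `r = b²γw'(1+γ⁴) ∈ 𝔫₀⁴`;
point chart `b` of the blow-up of `Q₀` (`chartSubst 1`): `g₃'(xb, b, ηb, yb) = b³·(x³ + b·η·y·(1 + η⁴b⁴))` and the
transform has order `3`
at the chart origin. [new; elementary] [folklore] -/
theorem Cx_C_wild_near_Q0 :
    (X 1 ^ 2 * X 2 * X 3 * (1 + X 2 ^ 4) : MvPolynomial (Fin 4) K) ∈ (Ideal.span {(X 0 : MvPolynomial (Fin 4) K), X 1, X 2, X 3}) ^ 4 ∧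
      aeval (chartSubst (K := K) 1) (X 0 ^ 3 + X 1 ^ 2 * X 2 * X 3 * (1 + X 2 ^ 4) : MvPolynomial (Fin 4) K) =
        X 1 ^ 3 * (X 0 ^ 3 + X 1 * X 2 * X 3 * (1 + X 2 ^ 4 * X 1 ^ 4)) ∧
      (X 0 ^ 3 + X 1 * X 2 * X 3 * (1 + X 2 ^ 4 * X 1 ^ 4) : MvPolynomial (Fin 4) K) ∈
        (Ideal.span {(X 0 : MvPolynomial (Fin 4) K), X 1, X 2, X 3}) ^ 3 := by
  refine ⟨?_, ?_, ?_⟩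
  · have h12 : (X 1 ^ 2 * X 2 : MvPolynomial (Fin 4) K) ∈ (Ideal.span {(X 0 : MvPolynomial (Fin 4) K), X 1, X 2, X 3}) ^ (2 + 1) :=
      mul_mem_pow_add (Ideal.pow_mem_pow (X_mem_spanX4 1) 2) (by rw [pow_one]; exact X_mem_spanX4 2)
    have h123 : (X 1 ^ 2 * X 2 * X 3 : MvPolynomial (Fin 4) K) ∈ (Ideal.span {(X 0 : MvPolynomial (Fin 4) K), X 1, X 2, X 3}) ^ (2 + 1 + 1) :=
      mul_mem_pow_add h12 (by rw [pow_one]; exact X_mem_spanX4 3)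
    exact Ideal.mul_mem_right _ _ h123
  · simp [chartSubst]; ring
  · refine Ideal.add_mem _ (Ideal.pow_mem_pow (X_mem_spanX4 0) 3) ?_
    have h12 : (X 1 * X 2 : MvPolynomial (Fin 4) K) ∈ (Ideal.span {(X 0 : MvPolynomial (Fin 4) K), X 1, X 2, X 3}) ^ (1 + 1) :=
      mul_mem_pow_add (by rw [pow_one]; exact X_mem_spanX4 1) (by rw [pow_one]; exact X_mem_spanX4 2)
    have h123 : (X 1 * X 2 * X 3 : MvPolynomial (Fin 4) K) ∈ (Ideal.span {(X 0 : MvPolynomial (Fin 4) K), X 1, X 2, X 3}) ^ (1 + 1 + 1) :=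
      mul_mem_pow_add h12 (by rw [pow_one]; exact X_mem_spanX4 3)
    exact Ideal.mul_mem_right _ _ h123

/-- **KEY · at `Q₀` TOO, C× IS P∞**: `g₃' = P∞(α, γ(1+γ⁴), b, w')` LITERALLY — substituting `X₁ ↦ X₂·(1 + X₂⁴)`, `X₂ ↦ X₁` into
P∞ = `X₀³ + X₁·X₂²·X₃` gives `g₃'`; with `Cx_gamma_separable` dictionary (E) makes the germ of R3 at `Q₀` P∞'s germ
at its origin,
`λ = V(α,b,w')` and `ν = V(α,b,γ̂)` = P∞'s `s`- and `w`-axes. [new; elementary] [folklore] -/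
theorem Cx_C_isPinf_b :
    aeval (fun j : Fin 4 => if j = 1 then (X 2 * (1 + X 2 ^ 4) : MvPolynomial (Fin 4) K) else if j = 2 then X 1 else X j)
        (X 0 ^ 3 + X 1 * X 2 ^ 2 * X 3 : MvPolynomial (Fin 4) K) =
      X 0 ^ 3 + X 1 ^ 2 * X 2 * X 3 * (1 + X 2 ^ 4) := by
  simp; ring

/-! #### R3 → R4 — SECOND SEPARATING HOP off the bad fibres: the line charts of `λ = V(α, u, w')` (`linChartSubst
{0,2,3}` on `g₃`), the
chart `h` of `μ = V(α, u, h)`, and the line charts of `ν = V(α, b, γ)` (`linChartSubst {0,1,2}` on `g₃'`) -/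

/-- `λ`-chart `u`: `g₃(α'u, β, u, w''u) = u³·(α'³ + w''·h)`. [new; elementary] [folklore] -/
theorem Cx_D_lineChart_X2 :
    aeval (linChartSubst (K := K) {0, 2, 3} 2) (X 0 ^ 3 + X 2 ^ 2 * X 3 * (X 1 ^ 4 + 1) : MvPolynomial (Fin 4) K) =
      X 2 ^ 3 * (X 0 ^ 3 + X 3 * (X 1 ^ 4 + 1)) := by
  simp [linChartSubst]; ring

/-- `λ`-chart `w'`: `g₃(α'w', β, u'w', w') = w'³·(α'³ + u'²·h)`. [new; elementary] [folklore] -/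
theorem Cx_D_lineChart_X3 :
    aeval (linChartSubst (K := K) {0, 2, 3} 3) (X 0 ^ 3 + X 2 ^ 2 * X 3 * (X 1 ^ 4 + 1) : MvPolynomial (Fin 4) K) =
      X 3 ^ 3 * (X 0 ^ 3 + X 2 ^ 2 * (X 1 ^ 4 + 1)) := by
  simp [linChartSubst]; ring

/-- `λ`-chart `α`: `g₃(α, β, u'α, w''α) = α³·(1 + u'²·w''·h)`. [new; elementary] [folklore] -/
theorem Cx_D_lineChart_X0 :
    aeval (linChartSubst (K := K) {0, 2, 3} 0) (X 0 ^ 3 + X 2 ^ 2 * X 3 * (X 1 ^ 4 + 1) : MvPolynomial (Fin 4) K) =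
      X 0 ^ 3 * (1 + X 2 ^ 2 * X 3 * (X 1 ^ 4 + 1)) := by
  simp [linChartSubst]; ring

/-- **`λ`-chart `u` — NO top point**: `α'³ + w''·h` (`∂_{w''}`: `s²h ∈ 𝔮²`, so `h ∈ 𝔮`; `∂_β`: `β³ ∈ 𝔮`; `1 = h − β⁴ ∈ 𝔮`).
[new; elementary] [folklore] -/
theorem Cx_D_lineChart_X2_noTop [CharP K 3] (𝔮 : Ideal (MvPolynomial (Fin 4) K)) [𝔮.IsPrime] {s : MvPolynomial (Fin 4) K}
    (hs : s ∉ 𝔮) (h : s * (X 0 ^ 3 + X 3 * (X 1 ^ 4 + 1) : MvPolynomial (Fin 4) K) ∈ 𝔮 ^ 3) : False := by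
  have hs2 : s ^ 2 ∉ 𝔮 := pow_not_mem 𝔮 hs 2
  have hs4 : (s ^ 2) ^ 2 ∉ 𝔮 := pow_not_mem 𝔮 hs2 2
  have h4 : (4 : MvPolynomial (Fin 4) K) ∉ 𝔮 := by
    have := natCast_not_mem (K := K) 𝔮 (m := 4) (by decide)
    exact_mod_cast this
  have e30 := f_ne K (i := 3) (j := 0) (by decide)
  have e31 := f_ne K (i := 3) (j := 1) (by decide)
  have e33 := f_self K 3
  have e11 := f_self K 1
  have d3 : pderiv 3 (X 0 ^ 3 + X 3 * (X 1 ^ 4 + 1) : MvPolynomial (Fin 4) K) = X 1 ^ 4 + 1 := by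
    simp only [map_add, Derivation.leibniz, Derivation.leibniz_pow, smul_eq_mul, nsmul_eq_mul, e30, e31, e33, f_one]
    push_cast; ring
  have dh : pderiv 1 (X 1 ^ 4 + 1 : MvPolynomial (Fin 4) K) = 4 * X 1 ^ 3 := by
    simp only [map_add, Derivation.leibniz_pow, smul_eq_mul, nsmul_eq_mul, e11, f_one]
    push_cast; ring
  have h3 := sq_mul_deriv_mem_pow 𝔮 h (pderiv 3)
  rw [d3] at h3
  have hh : (X 1 ^ 4 + 1 : MvPolynomial (Fin 4) K) ∈ 𝔮 := (‹𝔮.IsPrime›.mem_or_mem (Ideal.pow_le_self two_ne_zero h3)).resolve_left hs2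
  have h31 := sq_mul_deriv_mem_pow 𝔮 h3 (pderiv 1)
  rw [dh, pow_one] at h31
  obtain ⟨_, _, hd⟩ := Cx_h_separable 𝔮 hh
  exact hd h4 ((‹𝔮.IsPrime›.mem_or_mem h31).resolve_left hs4)

/-- **`λ`-chart `w'` — top points only over `Q`**: every prime of order `≥ 3` for `α'³ + u'²·h` contains `h`
(`∂_{u'}∂_{u'}`: `2h`)
— off the `Q`-fibres (`h` a unit) there is NO top point. [new; elementary] [folklore] -/
theorem Cx_D_lineChart_X3_top [CharP K 3] (𝔮 : Ideal (MvPolynomial (Fin 4) K)) [𝔮.IsPrime] {s : MvPolynomial (Fin 4) K}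
    (hs : s ∉ 𝔮) (h : s * (X 0 ^ 3 + X 2 ^ 2 * (X 1 ^ 4 + 1) : MvPolynomial (Fin 4) K) ∈ 𝔮 ^ 3) :
    (X 1 ^ 4 + 1 : MvPolynomial (Fin 4) K) ∈ 𝔮 := by
  have hs2 : s ^ 2 ∉ 𝔮 := pow_not_mem 𝔮 hs 2
  have hs4 : (s ^ 2) ^ 2 ∉ 𝔮 := pow_not_mem 𝔮 hs2 2
  have h2 : (2 : MvPolynomial (Fin 4) K) ∉ 𝔮 := two_not_mem (K := K) 𝔮
  have e20 := f_ne K (i := 2) (j := 0) (by decide)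
  have e21 := f_ne K (i := 2) (j := 1) (by decide)
  have e22 := f_self K 2
  have d2 : pderiv 2 (X 0 ^ 3 + X 2 ^ 2 * (X 1 ^ 4 + 1) : MvPolynomial (Fin 4) K) = 2 * (X 2 * (X 1 ^ 4 + 1)) := by
    simp only [map_add, Derivation.leibniz, Derivation.leibniz_pow, smul_eq_mul, nsmul_eq_mul, e20, e21, e22, f_one]
    push_cast; ring
  have d22 : pderiv 2 (2 * (X 2 * (X 1 ^ 4 + 1)) : MvPolynomial (Fin 4) K) = 2 * (X 1 ^ 4 + 1) := by
    simp only [map_add, Derivation.leibniz, Derivation.leibniz_pow, smul_eq_mul, nsmul_eq_mul, e21, e22, f_one, f_two]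
    push_cast; ring
  have h2' := sq_mul_deriv_mem_pow 𝔮 h (pderiv 2)
  rw [d2] at h2'
  have h22 := sq_mul_deriv_mem_pow 𝔮 h2' (pderiv 2)
  rw [d22, pow_one] at h22
  rcases ‹𝔮.IsPrime›.mem_or_mem h22 with h' | h'
  · exact absurd h' hs4
  exact (‹𝔮.IsPrime›.mem_or_mem h').resolve_left h2

/-- **`λ`-chart `α` — NO top point**: `1 + u'²w''h` (`∂_{w''}`: `u'²h ∈ 𝔮`, then `1 ∈ 𝔮`). [new; elementary] [folklore] -/
theorem Cx_D_lineChart_X0_noTop (𝔮 : Ideal (MvPolynomial (Fin 4) K)) [𝔮.IsPrime] {s : MvPolynomial (Fin 4) K} (hs : s ∉ 𝔮)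
    (h : s * (1 + X 2 ^ 2 * X 3 * (X 1 ^ 4 + 1) : MvPolynomial (Fin 4) K) ∈ 𝔮 ^ 3) : False := by
  have hs2 : s ^ 2 ∉ 𝔮 := pow_not_mem 𝔮 hs 2
  have e31 := f_ne K (i := 3) (j := 1) (by decide)
  have e32 := f_ne K (i := 3) (j := 2) (by decide)
  have e33 := f_self K 3
  have d3 : pderiv 3 (1 + X 2 ^ 2 * X 3 * (X 1 ^ 4 + 1) : MvPolynomial (Fin 4) K) = X 2 ^ 2 * (X 1 ^ 4 + 1) := by
    simp only [map_add, Derivation.leibniz, Derivation.leibniz_pow, smul_eq_mul, nsmul_eq_mul, e31, e32, e33, f_one]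
    push_cast; ring
  have h3 := sq_mul_deriv_mem_pow 𝔮 h (pderiv 3)
  rw [d3] at h3
  have hk : (X 2 ^ 2 * (X 1 ^ 4 + 1) : MvPolynomial (Fin 4) K) ∈ 𝔮 :=
    (‹𝔮.IsPrime›.mem_or_mem (Ideal.pow_le_self two_ne_zero h3)).resolve_left hs2
  have hf : (1 + X 2 ^ 2 * X 3 * (X 1 ^ 4 + 1) : MvPolynomial (Fin 4) K) ∈ 𝔮 := mem_of_sMul_mem_cube 𝔮 hs h
  have h1mem : (1 : MvPolynomial (Fin 4) K) ∈ 𝔮 := by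
    have := Ideal.sub_mem _ hf (Ideal.mul_mem_left _ (X 3) hk)
    rwa [show (1 + X 2 ^ 2 * X 3 * (X 1 ^ 4 + 1) - X 3 * (X 2 ^ 2 * (X 1 ^ 4 + 1)) : MvPolynomial (Fin 4) K) = 1 by ring] at this
  exact one_not_mem_of_isPrime 𝔮 h1mem

/-- **`μ`-chart `h`** (Rees chart `D₊(h)` of the blow-up of `μ = V(α, u, h)`: `α = α'·h`, `u = u'·h`; a polynomial identity):
`g₃(α'h, β, u'h, w') = h³·(α'³ + u'²·w')`. [new; elementary] [folklore] -/
theorem Cx_D_muChart_h :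
    aeval (fun j : Fin 4 => if j = 0 then X 0 * (X 1 ^ 4 + 1) else if j = 2 then X 2 * (X 1 ^ 4 + 1) else (X j : MvPolynomial (Fin 4) K))
        (X 0 ^ 3 + X 2 ^ 2 * X 3 * (X 1 ^ 4 + 1) : MvPolynomial (Fin 4) K) =
      (X 1 ^ 4 + 1) ^ 3 * (X 0 ^ 3 + X 2 ^ 2 * X 3) := by
  simp; ring

end RefCertificates

end Summit.ResolutionOfSingularities.ResolutionOfSingularities.Theorems.DeltaCutClasses
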